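import Summits.Ventures.CertifiedManyBodySolver.Downfold.RouterWordScoreV8PreregG16

/-!
# The Fe-pnictide TYPING FAMILIES of the v8 validation set in closed form (I): FEPAIR, ORDPAIR, UNION
# (score-2's registrations of 2026-08-29 — PREREG §E blocks 1–9 of seat g18, receipts of seat g19 — as kernel facts of the
# ACCEPTANCE §4.2 router-word score)

Venture CertifiedManyBodySolver, cell `pub/hubbard-downfold`, seat hubbard-downfold-score-2 (gen 19); namespace
`Summit.Ventures.CertifiedManyBodySolver.Downfold.RouterScore`. Everything here is PROVED (no `sorry`, standard axioms).

The curators type every iron-pnictide SHEET row of the v8 slate with one of four expected-word lists (truth files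
`validation/truth/M4xx.truth.json`, field `expected_router_words`; the lead's rulings R-uk / R-uo / R-ur / R-vb / R-vf / R-vg):
FEPAIR = «UND:MULTIORB+EPH | UND:MULTIORB» (M457 Sr₄Sc₂O₆Fe₂As₂, M458 Ca₄Al₂O₆Fe₂As₂, M460 EuFe₂P₂, M466 LaFe₂As₂-CT, the 1111 /
122 parents) — «the k-head REQUIREMENT test»; ORDPAIR = «UND:MULTIORB | UND:MULTIORB+EPH» (M455, M468 Sr₂Cr₃As₂O₂); TRIPLE =
«EPH | UND:MIXED+EPH | UND:MULTIORB+EPH» (M453 CaFe₂P₂, M467 Sr₂CrCoAsO₃); UNION = «UND:MIXED+EPH | UND:MULTIORB+EPH | UND:MIXED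
| UND:MULTIORB» (M454 SrFe₂P₂, M465 LaFe₂As₂-UT). score-2 registered, BEFORE any descriptor, a CONSEQUENCE TABLE per typing
(router_score.py `5825c1a541290400`, notes 'sr4sc2o6fe2as2' / 'ca4al2o6fe2as2' / 'eufe2p2' / 'srfe2p2' / 'lafe2as2-ut' /
'sr2cr3as2o2' …): which print shapes score AGREE / PARTIAL / DISAGREE / ABSTAIN(structure) under each typing. This file and
its sequel `RouterWordScoreFePnictideTypingsTriple.lean` replace those finitely many table lines by CLOSED FORMS valid for
EVERY print `p :: tl` over the open head grammar (`Head.other n` included):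

* §1 two general facts of the §4.2 score: `outcome_eq_partial_of` (no full match but some typed primary emitted ⇒ `PARTIAL`)
  and `outcome_alts_congr` (the verdict depends on the expectation only through the SET of its alternatives — so ORDPAIR
  and FEPAIR score every print identically, `score_ordpair_eq_fepair`);
* §2 the four typings (none expects a structural primary); §3 the closed forms `score_fepair` / `score_union` as `if`-chains
  on (is `p` structural?, which head is `p`?, which heads ride in `tl`?), with the `iff` corollaries the registrations quote:
  under FEPAIR a print is `AGREE` iff it is LED by «UND:MULTIORB» (riders never hurt, nothing else rescues it), `PARTIAL` iff
  «UND:MULTIORB» rides behind another non-structural head, `DISAGREE` iff «UND:MULTIORB» is absent from the print (bare «EPH»,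
  the straddle-only «UND:MIXED(…)+EPH», «BI», a lone «UND:HF(…)»); under UNION every d-headed print is `AGREE` and a print with
  no d-head anywhere is `DISAGREE`. (TRIPLE, the typing comparison, the receipts and ruling R-vh are in the sequel.)

WHAT THIS IS NOT: not physics and not a statement about any material's superconductivity; not the scorer of record
(deputy-2 `score.py::router_score`, mirrored by `router_score.py::outcome`, kernel twin `RouterWordScore.lean`); not a
typing RULING (the curators and the lead type the rows — this file only says what each typing makes of each print); the
heads carry no payload (the «(k=5; J_H)» / «(r_man …)» parentheses are stripped by `head()` before scoring, exactly as here).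
-/

namespace Summit.Ventures.CertifiedManyBodySolver.Downfold

namespace RouterScore

/-! ## §1 Two general facts: the PARTIAL clause in closed form, and set-dependence on the alternatives -/

section general

variable {α : Type*} [DecidableEq α] (structural : α → Bool)

/-- THE PARTIAL CLAUSE. With an expectation registered and the structure gate closed, a print that fully matches NO
alternative but emits SOME alternative's primary scores `PARTIAL`. [folklore] -/
theorem outcome_eq_partial_of {p : α} {tl : List α} {alts : List (List α)} (halts : alts ≠ [])
    (hgate : (structural p && !expectsStructural structural alts) = false)
    (hnofull : ∀ a ∈ alts, fullMatch (p :: tl) a = false) (hprim : ∃ a ∈ alts, primaryEmitted (p :: tl) a = true) :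
    outcome structural (p :: tl) alts = .PARTIAL := by
  rw [outcome_cons, if_neg halts, if_neg (by simp [hgate])]
  have hm : alts.any (fullMatch (p :: tl)) = false := by
    rw [List.any_eq_false]
    intro a ha h
    rw [hnofull a ha] at h
    exact Bool.false_ne_true h
  have hq : alts.any (primaryEmitted (p :: tl)) = true := List.any_eq_true.2 hprim
  rw [hm, hq]
  rfl

omit [DecidableEq α] in
/-- `List.any` depends on the list only through membership. [folklore] -/
theorem any_congr_mem {l l' : List (List α)} (h : ∀ a, a ∈ l ↔ a ∈ l') (f : List α → Bool) :
    l.any f = l'.any f := by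
  cases hv : l'.any f with
  | true =>
    obtain ⟨a, ha, hfa⟩ := List.any_eq_true.1 hv
    exact List.any_eq_true.2 ⟨a, (h a).2 ha, hfa⟩
  | false =>
    rw [List.any_eq_false]
    intro a ha hfa
    have : l'.any f = true := List.any_eq_true.2 ⟨a, (h a).1 ha, hfa⟩
    rw [hv] at this
    exact Bool.false_ne_true this

/-- SET-DEPENDENCE ON THE ALTERNATIVES. Two expectations with the same SET of alternatives score every print identically
(order and repetition of the typed words are immaterial: ORDPAIR ≡ FEPAIR, COTRIPLE ≡ TRIPLE). [folklore] -/
theorem outcome_alts_congr (e : List α) {alts alts' : List (List α)} (h : ∀ a, a ∈ alts ↔ a ∈ alts') :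
    outcome structural e alts = outcome structural e alts' := by
  cases e with
  | nil => rfl
  | cons p tl =>
    have hnil : (alts = []) ↔ (alts' = []) := by
      constructor
      · intro h0
        rcases alts' with _ | ⟨a, rest⟩
        · rfl
        · exact absurd ((h a).2 (List.mem_cons_self)) (by rw [h0]; simp)
      · intro h0
        rcases alts with _ | ⟨a, rest⟩
        · rfl
        · exact absurd ((h a).1 (List.mem_cons_self)) (by rw [h0]; simp)
    have hexp : expectsStructural structural alts = expectsStructural structural alts' := by
      unfold expectsStructural
      exact any_congr_mem h _
    rw [outcome_cons, outcome_cons, hexp, any_congr_mem h (fullMatch (p :: tl)),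
      any_congr_mem h (primaryEmitted (p :: tl))]
    by_cases h0 : alts = []
    · rw [if_pos h0, if_pos (hnil.1 h0)]
    · rw [if_neg h0, if_neg (fun h' => h0 (hnil.2 h'))]

end general

open Head

/-! ## §2 The four typings of the iron-pnictide sheet rows (truth files, field `expected_router_words`) -/

/-- FEPAIR «UND:MULTIORB+EPH | UND:MULTIORB» (M457 / M458 / M460 / M466; the 1111 / 122 parents). [folklore] -/
def fepair : List (List Head) := [[undMultiorb, eph], [undMultiorb]]

/-- ORDPAIR «UND:MULTIORB | UND:MULTIORB+EPH» (M455 / M468). [folklore] -/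
def ordpair : List (List Head) := [[undMultiorb], [undMultiorb, eph]]

/-- TRIPLE «EPH | UND:MIXED+EPH | UND:MULTIORB+EPH» (M453; M467 «COTRIPLE»). [folklore] -/
def triple : List (List Head) := [[eph], [undMixed, eph], [undMultiorb, eph]]

/-- UNION «UND:MIXED+EPH | UND:MULTIORB+EPH | UND:MIXED | UND:MULTIORB» (M454 / M465). [folklore] -/
def union : List (List Head) := [[undMixed, eph], [undMultiorb, eph], [undMixed], [undMultiorb]]

/-- None of the four typings expects a structural primary (so a «UND:STRUCT…»-led print abstains under each). [folklore] -/
theorem typings_expect_no_structural :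
    expectsStructural Head.structural fepair = false ∧ expectsStructural Head.structural ordpair = false ∧
    expectsStructural Head.structural triple = false ∧ expectsStructural Head.structural union = false := by decide

/-- ORDPAIR and FEPAIR have the same set of alternatives. [folklore] -/
theorem mem_ordpair_iff (a : List Head) : a ∈ ordpair ↔ a ∈ fepair := by
  simp only [ordpair, fepair, List.mem_cons, List.not_mem_nil, or_false]
  exact Or.comm

/-- ORDPAIR ≡ FEPAIR on every print (§1 set-dependence). [folklore] -/
theorem score_ordpair_eq_fepair (e : List Head) : score e ordpair = score e fepair :=
  outcome_alts_congr Head.structural e mem_ordpair_iff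

/-! ## §3 The closed forms -/

/-- a structural head abstains under each of the four typings. [folklore] -/
theorem score_structural_led (p : Head) (tl : List Head) (hp : p.structural = true) :
    score (p :: tl) fepair = .ABSTAIN_structure ∧ score (p :: tl) triple = .ABSTAIN_structure ∧
    score (p :: tl) union = .ABSTAIN_structure ∧ score (p :: tl) ordpair = .ABSTAIN_structure :=
  ⟨outcome_structural_abstain _ (by decide) hp typings_expect_no_structural.1,
   outcome_structural_abstain _ (by decide) hp typings_expect_no_structural.2.2.1,
   outcome_structural_abstain _ (by decide) hp typings_expect_no_structural.2.2.2,
   outcome_structural_abstain _ (by decide) hp typings_expect_no_structural.2.1⟩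

/-- `primaryEmitted` against a word led by `q`: it reads `q ∈ print`. [folklore] -/
theorem primaryEmitted_cons_eq (e : List Head) (q : Head) (secs : List Head) :
    primaryEmitted e (q :: secs) = decide (q ∈ e) := rfl

/-- `fullMatch` against a word led by `q` requires the print to be led by `q`. [folklore] -/
theorem fullMatch_eq_false_of_head_ne {p q : Head} {tl secs : List Head} (h : q ≠ p) :
    fullMatch (p :: tl) (q :: secs) = false := by
  simp only [fullMatch, List.head?_cons, Option.some.injEq, Bool.and_eq_false_imp, decide_eq_true_eq]
  exact fun hq => absurd hq h

/-- `fullMatch` fails as soon as one token of the word is missing from the print. [folklore] -/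
theorem fullMatch_eq_false_of_not_mem {e a : List Head} {t : Head} (ht : t ∈ a) (hte : t ∉ e) :
    fullMatch e a = false := by
  cases h : fullMatch e a with
  | false => rfl
  | true =>
    simp only [fullMatch, covers, Bool.and_eq_true, decide_eq_true_eq, List.all_eq_true] at h
    exact absurd (h.2 t ht) hte

/-- FEPAIR IN CLOSED FORM: structural head ⇒ abstain; led by «UND:MULTIORB» ⇒ `AGREE` (whatever rides); otherwise
`PARTIAL` iff «UND:MULTIORB» rides, else `DISAGREE`. [folklore] -/
theorem score_fepair (p : Head) (tl : List Head) :
    score (p :: tl) fepair =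
      (if p.structural then .ABSTAIN_structure
       else if p = undMultiorb then .AGREE
       else if undMultiorb ∈ tl then .PARTIAL else .DISAGREE) := by
  by_cases hs : p.structural = true
  · rw [if_pos hs]; exact (score_structural_led p tl hs).1
  rw [if_neg hs]
  have hs' : p.structural = false := by simpa using hs
  have hgate : (p.structural && !expectsStructural Head.structural fepair) = false := by rw [hs']; rfl
  by_cases hp : p = undMultiorb
  · rw [if_pos hp]; subst hp
    have : fepair = [[undMultiorb, eph]] ++ [undMultiorb :: []] := rfl
    rw [show score (undMultiorb :: tl) fepair = outcome Head.structural (undMultiorb :: tl) fepair from rfl, this]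
    exact outcome_eq_agree_of_self_typed Head.structural _ rfl (fun t ht => absurd ht (by simp))
  rw [if_neg hp]
  have hne : undMultiorb ≠ p := fun h => hp h.symm
  by_cases hm : undMultiorb ∈ tl
  · rw [if_pos hm]
    refine outcome_eq_partial_of Head.structural (by decide) hgate ?_ ⟨[undMultiorb], by simp [fepair], ?_⟩
    · intro a ha
      simp only [fepair, List.mem_cons, List.not_mem_nil, or_false] at ha
      rcases ha with rfl | rfl <;> exact fullMatch_eq_false_of_head_ne hne
    · rw [primaryEmitted_cons_eq]; simp [hm]
  · rw [if_neg hm]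
    refine outcome_eq_disagree_of_no_primary_emitted Head.structural (by decide) hgate ?_
    intro a ha
    simp only [fepair, List.mem_cons, List.not_mem_nil, or_false] at ha
    rcases ha with rfl | rfl <;> · rw [primaryEmitted_cons_eq]; simp [hm, hne]

/-- FEPAIR: `AGREE` iff the print is LED by «UND:MULTIORB». [folklore] -/
theorem fepair_agree_iff (p : Head) (tl : List Head) : score (p :: tl) fepair = .AGREE ↔ p = undMultiorb := by
  rw [score_fepair]
  by_cases hs : p.structural = true
  · rw [if_pos hs]; constructor
    · intro h; exact absurd h (by decide)
    · rintro rfl; exact absurd hs (by decide)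
  rw [if_neg hs]
  by_cases hp : p = undMultiorb
  · rw [if_pos hp]; exact ⟨fun _ => hp, fun _ => rfl⟩
  rw [if_neg hp]
  by_cases hm : undMultiorb ∈ tl
  · rw [if_pos hm]; exact ⟨fun h => absurd h (by decide), fun h => absurd h hp⟩
  · rw [if_neg hm]; exact ⟨fun h => absurd h (by decide), fun h => absurd h hp⟩

/-- FEPAIR: `PARTIAL` iff «UND:MULTIORB» rides behind another, non-structural head. [folklore] -/
theorem fepair_partial_iff (p : Head) (tl : List Head) :
    score (p :: tl) fepair = .PARTIAL ↔ p.structural = false ∧ p ≠ undMultiorb ∧ undMultiorb ∈ tl := by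
  rw [score_fepair]
  by_cases hs : p.structural = true
  · rw [if_pos hs]; simp [hs]
  rw [if_neg hs]
  have hs' : p.structural = false := by simpa using hs
  by_cases hp : p = undMultiorb
  · rw [if_pos hp]; simp [hp]
  rw [if_neg hp]
  by_cases hm : undMultiorb ∈ tl
  · rw [if_pos hm]; simp [hs', hp, hm]
  · rw [if_neg hm]; simp [hm]

/-- FEPAIR: `DISAGREE` iff the head is non-structural and «UND:MULTIORB» occurs nowhere in the print (bare «EPH»,
«EPH+UND:STRUCT», the straddle-only «UND:MIXED(…)+EPH», «BI», a lone «UND:HF(…)» …). [folklore] -/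
theorem fepair_disagree_iff (p : Head) (tl : List Head) :
    score (p :: tl) fepair = .DISAGREE ↔ p.structural = false ∧ undMultiorb ∉ p :: tl := by
  rw [score_fepair, List.mem_cons, not_or]
  by_cases hs : p.structural = true
  · rw [if_pos hs]; simp [hs]
  rw [if_neg hs]
  have hs' : p.structural = false := by simpa using hs
  by_cases hp : p = undMultiorb
  · rw [if_pos hp]; simp [hp]
  rw [if_neg hp]
  have hne : ¬ undMultiorb = p := fun h => hp h.symm
  by_cases hm : undMultiorb ∈ tl
  · rw [if_pos hm]; simp [hm]
  · rw [if_neg hm]; simp [hs', hne, hm]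

/-- UNION IN CLOSED FORM: structural head ⇒ abstain; led by «UND:MULTIORB» or «UND:MIXED» ⇒ `AGREE` (whatever rides);
otherwise `PARTIAL` iff one of the two d-heads rides, else `DISAGREE`. [folklore] -/
theorem score_union (p : Head) (tl : List Head) :
    score (p :: tl) union =
      (if p.structural then .ABSTAIN_structure
       else if p = undMultiorb ∨ p = undMixed then .AGREE
       else if undMultiorb ∈ tl ∨ undMixed ∈ tl then .PARTIAL else .DISAGREE) := by
  by_cases hs : p.structural = true
  · rw [if_pos hs]; exact (score_structural_led p tl hs).2.2.1
  rw [if_neg hs]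
  have hs' : p.structural = false := by simpa using hs
  have hgate : (p.structural && !expectsStructural Head.structural union) = false := by rw [hs']; rfl
  by_cases hp : p = undMultiorb ∨ p = undMixed
  · rw [if_pos hp]
    rcases hp with rfl | rfl
    · have : union = [[undMixed, eph], [undMultiorb, eph], [undMixed]] ++ [undMultiorb :: []] := rfl
      rw [show score (undMultiorb :: tl) union = outcome Head.structural (undMultiorb :: tl) union from rfl, this]
      exact outcome_eq_agree_of_self_typed Head.structural _ rfl (fun t ht => absurd ht (by simp))
    · rw [show score (undMixed :: tl) union = outcome Head.structural (undMixed :: tl) union from rfl]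
      rw [outcome_alts_congr Head.structural (undMixed :: tl)
        (alts' := [[undMixed, eph], [undMultiorb, eph], [undMultiorb]] ++ [undMixed :: []])
        (by intro a; simp only [union, List.mem_append, List.mem_cons, List.not_mem_nil, or_false]; tauto)]
      exact outcome_eq_agree_of_self_typed Head.structural _ rfl (fun t ht => absurd ht (by simp))
  rw [if_neg hp]
  have hne1 : undMultiorb ≠ p := fun h => hp (Or.inl h.symm)
  have hne2 : undMixed ≠ p := fun h => hp (Or.inr h.symm)
  by_cases hm : undMultiorb ∈ tl ∨ undMixed ∈ tl
  · rw [if_pos hm]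
    refine outcome_eq_partial_of Head.structural (by decide) hgate ?_ ?_
    · intro a ha
      simp only [union, List.mem_cons, List.not_mem_nil, or_false] at ha
      rcases ha with rfl | rfl | rfl | rfl
      · exact fullMatch_eq_false_of_head_ne hne2
      · exact fullMatch_eq_false_of_head_ne hne1
      · exact fullMatch_eq_false_of_head_ne hne2
      · exact fullMatch_eq_false_of_head_ne hne1
    · rcases hm with hm | hm
      · exact ⟨[undMultiorb], by simp [union], by rw [primaryEmitted_cons_eq]; simp [hm]⟩
      · exact ⟨[undMixed], by simp [union], by rw [primaryEmitted_cons_eq]; simp [hm]⟩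
  · rw [if_neg hm]
    rw [not_or] at hm
    refine outcome_eq_disagree_of_no_primary_emitted Head.structural (by decide) hgate ?_
    intro a ha
    simp only [union, List.mem_cons, List.not_mem_nil, or_false] at ha
    rcases ha with rfl | rfl | rfl | rfl <;> · rw [primaryEmitted_cons_eq]; simp [hm.1, hm.2, hne1, hne2]

/-- UNION: `AGREE` iff the print is led by one of the two d-heads («every d-headed print AGREE»). [folklore] -/
theorem union_agree_iff (p : Head) (tl : List Head) :
    score (p :: tl) union = .AGREE ↔ p = undMultiorb ∨ p = undMixed := by
  rw [score_union]
  by_cases hs : p.structural = true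
  · rw [if_pos hs]; constructor
    · intro h; exact absurd h (by decide)
    · rintro (rfl | rfl) <;> exact absurd hs (by decide)
  rw [if_neg hs]
  by_cases hp : p = undMultiorb ∨ p = undMixed
  · rw [if_pos hp]; exact ⟨fun _ => hp, fun _ => rfl⟩
  rw [if_neg hp]
  by_cases hm : undMultiorb ∈ tl ∨ undMixed ∈ tl
  · rw [if_pos hm]; exact ⟨fun h => absurd h (by decide), fun h => absurd h hp⟩
  · rw [if_neg hm]; exact ⟨fun h => absurd h (by decide), fun h => absurd h hp⟩

/-- UNION: a non-structural print with neither d-head anywhere is `DISAGREE` (bare «EPH», «EPH+UND:STRUCT», «BI» …).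
[folklore] -/
theorem union_disagree_iff (p : Head) (tl : List Head) :
    score (p :: tl) union = .DISAGREE ↔
      p.structural = false ∧ undMultiorb ∉ p :: tl ∧ undMixed ∉ p :: tl := by
  rw [score_union, List.mem_cons, List.mem_cons, not_or, not_or]
  by_cases hs : p.structural = true
  · rw [if_pos hs]; simp [hs]
  rw [if_neg hs]
  have hs' : p.structural = false := by simpa using hs
  by_cases hp : p = undMultiorb ∨ p = undMixed
  · rw [if_pos hp]
    rcases hp with rfl | rfl <;> simp
  rw [if_neg hp]
  rw [not_or] at hp
  have hne1 : ¬ undMultiorb = p := fun h => hp.1 h.symm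
  have hne2 : ¬ undMixed = p := fun h => hp.2 h.symm
  by_cases hm : undMultiorb ∈ tl ∨ undMixed ∈ tl
  · rw [if_pos hm]
    rcases hm with hm | hm <;> simp [hm]
  · rw [if_neg hm]; rw [not_or] at hm; simp [hs', hne1, hne2, hm.1, hm.2]

end RouterScore

end Summit.Ventures.CertifiedManyBodySolver.Downfold
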